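import Literature.AlgebraicGeometry.Motives.BaseChange
import Mathlib.RingTheory.Ideal.KrullsHeightTheorem
import Mathlib.RingTheory.Ideal.MinimalPrime.Noetherian
import Mathlib.AlgebraicGeometry.Noetherian
import HarnessLib

/-!
# Finitely many points of `X_σ` over a point of `X` (proof file for `Motives/BaseChange`)

Sibling proof file of `Literature/AlgebraicGeometry/Motives/BaseChange.lean`. That file vendors as a
*named fact* `Literature.AlgebraicGeometry.Motives.finite_pointsOver`: for a scheme `X` locally of
finite type over a field `k`, a homomorphism of fields `σ : k →+* L` and a point `z ∈ X`, the set
`pointsOver σ X z` of points `z'` of the base change `X_σ = X ×_{Spec k, σ} Spec L` with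
`π z' = z` (`π : X_σ ⟶ X` the projection) and `codim z' = codim z` (`Order.coheight` in the
specialisation order, i.e. `dim 𝒪_{X_σ,z'} = dim 𝒪_{X,z}`, Stacks 02IZ) is finite. This file
**discharges that fact** (`Literature.AlgebraicGeometry.Motives.finite_pointsOver_holds`) from
Mathlib alone.

## Proof

The printed argument (EGA IV₂ §4.4 and (6.1.2); Liu, *Algebraic Geometry and Arithmetic Curves*,
Thm. 4.3.12; Matsumura, *Commutative Ring Theory*, Thm. 15.1; Stacks 00ON): `π` is flat, so for
`z'` over `z` the **dimension formula** `dim 𝒪_{X_σ,z'} = dim 𝒪_{X,z} + dim 𝒪_{π⁻¹(z),z'}` holds;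
hence `codim z' = codim z` (a finite number, `X` being locally Noetherian) forces
`dim 𝒪_{π⁻¹(z),z'} = 0`, i.e. `z'` is a generic point of an irreducible component of the fibre,
and a Noetherian fibre has finitely many components. We run it affine-locally, entirely with
heights of prime ideals:

* *Commutative algebra* (`mem_minimalPrimes_of_liesOver_of_height_eq`,
  `finite_setOf_under_eq_and_height_eq`): for `R → S` with going-down (e.g. flat), `R`, `S`
  Noetherian and `p ⊂ R` prime, Mathlib's
  `Ideal.height_eq_height_add_of_liesOver_of_hasGoingDown` (Matsumura Thm. 15.1, Stacks 00ON)
  gives `ht P = ht p + ht (P / pS)` for `P` over `p`; so `ht P = ht p < ∞` makes `P` a minimal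
  prime of `pS`, of which there are finitely many (`Ideal.finite_minimalPrimes_of_isNoetherianRing`).
* *Glue* (`finite_inter_pointsOver`, `finite_pointsOver_holds`): pick an affine open `U ∋ z`;
  `π` is quasi-compact (base change of `Spec L ⟶ Spec k`), so `π⁻¹U` is a finite union of affine
  opens `V`; on each `V` the points correspond injectively to primes of `Γ(X_σ, V)`
  (`IsAffineOpen.primeIdealOf`), compatibly with `π` versus contraction along the flat ring map
  `Γ(X, U) → Γ(X_σ, V)` (Mathlib `IsAffineOpen.comap_primeIdealOf_appLE`,
  `HasRingHomProperty.appLE` for `@Flat`) and with `codim` versus height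
  (Mathlib `idealHeight_eq_coheight`, `coheight_eq_of_isOpenImmersion`); both `X` and `X_σ` are
  locally Noetherian, being locally of finite type over fields
  (`LocallyOfFiniteType.isLocallyNoetherian`).

## References

* Q. Liu, *Algebraic Geometry and Arithmetic Curves* (2002), Thm. 4.3.12 (dimension formula for
  flat morphisms of locally Noetherian schemes). [Liu2002]
* H. Matsumura, *Commutative Ring Theory* (1986), Thm. 15.1. [Matsumura1987]
* A. Grothendieck, J. Dieudonné, EGA IV₂ (1965), §4.4 and Cor. (6.1.2).
* The Stacks Project, Tags 00ON (dimension formula under going-down), 02IZ (`dim 𝒪_{X,x}` is the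
  codimension of `x`). [StacksProject]
-/

universe u

open CategoryTheory AlgebraicGeometry Limits Order

noncomputable section

namespace Literature.AlgebraicGeometry.Motives

namespace FinitePointsOver

/-! ### Commutative algebra: primes over `p` of the same height -/

section CommAlg

variable {R S : Type*} [CommRing R] [CommRing S] [Algebra R S]

/-- Let `R → S` satisfy going-down (e.g. be flat), with `R` and `S` Noetherian, and let the prime
`P ⊂ S` lie over the prime `p ⊂ R`. If `ht P = ht p`, then `P` is a minimal prime over `pS`:
by the dimension formula `ht P = ht p + ht (P/pS)` (Matsumura, *Commutative Ring Theory*,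
Thm. 15.1 (ii); Stacks 00ON; Mathlib `Ideal.height_eq_height_add_of_liesOver_of_hasGoingDown`)
and finiteness of `ht p`, the image of `P` in `S/pS` has height `0`.
[cite: Matsumura1987, Thm. 15.1] -/
theorem mem_minimalPrimes_of_liesOver_of_height_eq [IsNoetherianRing R] [IsNoetherianRing S]
    [Algebra.HasGoingDown R S] (p : Ideal R) [p.IsPrime] (P : Ideal S) [P.IsPrime] [P.LiesOver p]
    (h : P.height = p.height) : P ∈ (p.map (algebraMap R S)).minimalPrimes := by
  have hf := Ideal.height_eq_height_add_of_liesOver_of_hasGoingDown p P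
  have hp : p.height ≠ ⊤ := Ideal.height_ne_top_of_isPrime
  have hle : p.map (algebraMap R S) ≤ P :=
    Ideal.map_le_iff_le_comap.mpr (Ideal.LiesOver.over (P := P) (p := p)).le
  haveI : (P.map (Ideal.Quotient.mk (p.map (algebraMap R S)))).IsPrime :=
    Ideal.isPrime_map_quotientMk_of_isPrime hle
  have h0 : (P.map (Ideal.Quotient.mk (p.map (algebraMap R S)))).height = 0 :=
    WithTop.add_left_cancel hp (hf.symm.trans (h.trans (add_zero _).symm))
  rw [Ideal.height_eq_zero_iff] at h0
  rw [Ideal.minimalPrimes_eq_comap]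
  exact ⟨_, h0, Ideal.comap_map_mk hle⟩

/-- Let `R → S` satisfy going-down (e.g. be flat), with `R` and `S` Noetherian, and let `p ⊂ R` be
a prime. Then only finitely many primes `P ⊂ S` lie over `p` with `ht P = ht p`: they are among
the minimal primes of `pS` (`mem_minimalPrimes_of_liesOver_of_height_eq`, the dimension formula,
Matsumura Thm. 15.1 / Stacks 00ON), a finite set since `S` is Noetherian
(Mathlib `Ideal.finite_minimalPrimes_of_isNoetherianRing`). [cite: StacksProject, Tag 00ON] -/
theorem finite_setOf_under_eq_and_height_eq [IsNoetherianRing R] [IsNoetherianRing S]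
    [Algebra.HasGoingDown R S] (p : Ideal R) [p.IsPrime] :
    {P : PrimeSpectrum S | P.asIdeal.under R = p ∧ P.asIdeal.height = p.height}.Finite := by
  refine ((Ideal.finite_minimalPrimes_of_isNoetherianRing S (p.map (algebraMap R S))).preimage
    (f := PrimeSpectrum.asIdeal) (fun _ _ _ _ h ↦ PrimeSpectrum.ext h)).subset ?_
  rintro P ⟨hP, hh⟩
  haveI : P.asIdeal.LiesOver p := ⟨hP.symm⟩
  exact mem_minimalPrimes_of_liesOver_of_height_eq p P.asIdeal hh

end CommAlg

/-! ### Points of an affine open and primes of its coordinate ring -/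

section Affine

/-- For an affine open `U` of a scheme `X`, the map `x ↦ 𝔭_x ⊂ Γ(X, U)` from points of `U` to
primes (Mathlib `IsAffineOpen.primeIdealOf`, i.e. the isomorphism `U ≅ Spec Γ(X, U)` on points)
is injective (Hartshorne II.2; cf. the same remark in `Motives/SubschemeCyclesFinsuppProofs`).
[folklore] -/
theorem primeIdealOf_injective {X : Scheme.{u}} {U : X.Opens} (hU : IsAffineOpen U) :
    Function.Injective hU.primeIdealOf := by
  intro x y h
  have := congr(hU.fromSpec $h)
  rw [hU.fromSpec_primeIdealOf, hU.fromSpec_primeIdealOf] at this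
  exact Subtype.ext this

/-- For a point `x` of an affine open `U ⊆ X`, the height of its prime `𝔭_x ⊂ Γ(X, U)` is the
codimension of `x` in `X` (`Order.coheight` in the specialisation order): both equal
`dim 𝒪_{X,x}` (Stacks 02IZ; Mathlib `idealHeight_eq_coheight` on `Spec Γ(X, U)`, transported
along the open immersions `Spec Γ(X, U) ≅ U ↪ X`, Stacks 02I4, Mathlib
`coheight_eq_of_isOpenImmersion`). [cite: StacksProject, Tag 02IZ] -/
theorem height_primeIdealOf {X : Scheme.{u}} {U : X.Opens} (hU : IsAffineOpen U) (x : U) :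
    (hU.primeIdealOf x).asIdeal.height = coheight (x : X) := by
  have h1 := idealHeight_eq_coheight Γ(X, U) (hU.primeIdealOf x)
  have h2 := coheight_eq_of_isOpenImmersion (x := x) hU.isoSpec.hom
  have h3 := coheight_eq_of_isOpenImmersion (x := x) U.ι
  exact h1.trans (h2.trans h3.symm)

end Affine

/-! ### The points over `z` inside one affine open of `X_σ` -/

section Local

variable {k L : Type u} [Field k] [Field L] (σ : k →+* L) (X : SchemeOver k)

/-- The projection `π : X_σ ⟶ X` is quasi-compact: it is the base change of the affine, hence
quasi-compact, morphism `Spec L ⟶ Spec k` (Hartshorne II Ex. 3.2; Mathlib's stability of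
`@QuasiCompact` under base change, through `baseChangeHomFst = pullback.fst`). Stated as a
theorem; use with `haveI`. [folklore] -/
theorem quasiCompact_baseChangeHomFst : QuasiCompact (baseChangeHomFst σ X) :=
  MorphismProperty.pullback_fst _ _ inferInstance

/-- **Local finiteness.** Let `X` be locally of finite type over `k`, `U ∋ z` an affine open of `X`
and `V ⊆ π⁻¹U` an affine open of `X_σ`. Then only finitely many `z' ∈ V` lie in
`pointsOver σ X z` (i.e. `π z' = z` and `codim z' = codim z`): under `z' ↦ 𝔭_{z'} ⊂ Γ(X_σ, V)`
(injective) they go to primes lying over `𝔭_z ⊂ Γ(X, U)` along the flat ring map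
`Γ(X, U) → Γ(X_σ, V)` (Mathlib `IsAffineOpen.comap_primeIdealOf_appLE`) of the same height
(`height_primeIdealOf`), a finite set by the dimension formula for flat morphisms
(Liu Thm. 4.3.12, Matsumura Thm. 15.1; `finite_setOf_under_eq_and_height_eq`), `Γ(X, U)` and
`Γ(X_σ, V)` being Noetherian (`X`, `X_σ` locally of finite type over fields).
[cite: Liu2002, Thm. 4.3.12] -/
theorem finite_inter_pointsOver [LocallyOfFiniteType X.hom] {U : X.left.Opens}
    (hU : IsAffineOpen U) {z : X.left} (hzU : z ∈ U)
    {V : ((baseChangeHom σ).obj X).left.Opens} (hV : IsAffineOpen V)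
    (hVU : V ≤ (baseChangeHomFst σ X) ⁻¹ᵁ U) :
    ((V : Set ((baseChangeHom σ).obj X).left) ∩ pointsOver σ X z).Finite := by
  have : IsLocallyNoetherian X.left := LocallyOfFiniteType.isLocallyNoetherian X.hom
  have : IsLocallyNoetherian ((baseChangeHom σ).obj X).left := by
    rw [baseChangeHom_obj_left]; exact inferInstance
  have : IsNoetherianRing Γ(X.left, U) := IsLocallyNoetherian.component_noetherian ⟨U, hU⟩
  have : IsNoetherianRing Γ(((baseChangeHom σ).obj X).left, V) :=
    IsLocallyNoetherian.component_noetherian ⟨V, hV⟩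
  -- the flat ring map `Γ(X, U) → Γ(X_σ, V)` induced by the flat morphism `π`
  have hflat : ((baseChangeHomFst σ X).appLE U V hVU).hom.Flat :=
    HasRingHomProperty.appLE @Flat (baseChangeHomFst σ X) inferInstance ⟨U, hU⟩ ⟨V, hV⟩ hVU
  algebraize [((baseChangeHomFst σ X).appLE U V hVU).hom]
  set p := hU.primeIdealOf ⟨z, hzU⟩ with hp
  have hF := finite_setOf_under_eq_and_height_eq (S := Γ(((baseChangeHom σ).obj X).left, V))
    p.asIdeal
  refine ((hF.preimage (primeIdealOf_injective hV).injOn).image Subtype.val).subset ?_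
  rintro z' ⟨hz'V, hπ, hco⟩
  refine ⟨⟨z', hz'V⟩, ⟨?_, ?_⟩, rfl⟩
  · -- `𝔭_{z'}` lies over `𝔭_{π z'} = 𝔭_z`
    refine (congr($(IsAffineOpen.comap_primeIdealOf_appLE U hU V hV hVU hz'V).asIdeal)).trans ?_
    rw [hp]
    congr 2
    exact Subtype.ext hπ
  · -- heights are codimensions
    rw [height_primeIdealOf, height_primeIdealOf]
    exact hco

end Local

end FinitePointsOver

/-! ### The discharge -/

section Discharge

open FinitePointsOver

variable {k L : Type u} [Field k] [Field L] (σ : k →+* L) (X : SchemeOver k)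

/-- **Discharge of `finite_pointsOver`.** For `X` locally of finite type over a field `k`, a
homomorphism of fields `σ : k →+* L` and `z ∈ X`, only finitely many points `z'` of
`X_σ = X ×_{Spec k, σ} Spec L` lie over `z` with `codim z' = codim z`; they are the generic points
of the irreducible components of the (Noetherian) fibre `π⁻¹(z)`, by the dimension formula for the
flat morphism `π : X_σ ⟶ X`, `dim 𝒪_{X_σ,z'} = dim 𝒪_{X,z} + dim 𝒪_{π⁻¹(z),z'}` (Liu,
*Algebraic Geometry and Arithmetic Curves*, Thm. 4.3.12; EGA IV₂ (6.1.2); Matsumura Thm. 15.1;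
Stacks 00ON). Proof: `π` is quasi-compact, so the preimage of an affine open `U ∋ z` is a finite
union of affine opens `V`, on each of which `finite_inter_pointsOver` applies.
[cite: Liu2002, Thm. 4.3.12] -/
theorem finite_pointsOver_holds : finite_pointsOver σ X := by
  intro _ z
  haveI := quasiCompact_baseChangeHomFst σ X
  -- an affine open neighbourhood `U` of `z`, and a finite affine open cover of `π⁻¹U`
  obtain ⟨_, ⟨U, hU, rfl⟩, hzU, -⟩ :=
    X.left.isBasis_affineOpens.exists_subset_of_mem_open (Set.mem_univ z) isOpen_univ
  obtain ⟨s, hs, hcov⟩ := isCompact_iff_finite_and_eq_biUnion_affineOpens.mp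
    ((baseChangeHomFst σ X).isCompact_preimage (U := U) hU.isCompact)
  refine (hs.biUnion fun V hVs ↦ finite_inter_pointsOver σ X hU hzU V.2 ?_).subset ?_
  · rw [hcov]
    exact le_iSup₂ (f := fun (i : ((baseChangeHom σ).obj X).left.affineOpens) (_ : i ∈ s) ↦
      (i : ((baseChangeHom σ).obj X).left.Opens)) V hVs
  · intro z' hz'
    have hmem : z' ∈ (baseChangeHomFst σ X) ⁻¹ᵁ U := by
      change (baseChangeHomFst σ X).base z' ∈ U
      rw [hz'.1]
      exact hzU
    rw [hcov, TopologicalSpace.Opens.mem_iSup] at hmem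
    obtain ⟨V, hV⟩ := hmem
    rw [TopologicalSpace.Opens.mem_iSup] at hV
    obtain ⟨hVs, hz'V⟩ := hV
    exact Set.mem_biUnion hVs ⟨hz'V, hz'⟩

end Discharge

end Literature.AlgebraicGeometry.Motives

end
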